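import Literature.IUT.HodgeTheaters.PuncturedEllipticCoveringsCuspsProofs
import Literature.IUT.HodgeTheaters.PuncturedEllipticCoveringsSplitting
import Literature.IUT.HodgeTheaters.PuncturedEllipticCoveringsOpenProofs
import HarnessLib

/-!
# [IUTchI] §1 p. 38 — three clauses of the printed claims DERIVED from print's own Δ_ε-level sentences

Mochizuki, *Inter-universal Teichmüller theory I*, kurims manuscript (May 2020), §1 pp. 37–38
[cite: Mochizuki2012, IUTchI §1 pp.37-38] (D-0012 claim key, status disputed).  PROOF-ONLY companion of
`PuncturedEllipticCoverings.lean` (abc-iut-L5-t1, p404449) and `PuncturedEllipticCoveringsCusps.lean`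
(p424023): no `def`, no instance, no new `Prop` fact; cell abc-iut, DAG nodes `IUTchI:Def1.1`/`IUTchI:Cor1.2`;
abc-iut-L5-lead RULINGS #58 (10) GO «hA re-grounding» — file B1 of the series that derives the standing
Layer-5 certificate binder `hA : D.ArrowCoveringClaims` (13 clauses about the §1 CONSTRUCTION `jKer`,
`Π_{X̲→}`, `Π_{C̲→}`) from classical-shaped laws on the standard objects `I_x`, `Δ_X̲^{ab} ⊗ ℤ/l`, `Δ_ε`.

THE LAWS used in this file (explicit hypothesis binders; the named structure `ModLCuspLaws` collecting them
is filed separately, and the assembly `ArrowCoveringClaims_of_modLCuspLaws` cites these theorems BY NAME):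
* (L4) `hI3 : ∀ x, ∀ g ∈ Π_X̲, ∀ z ∈ I_x, g z g⁻¹ z⁻¹ ∈ Ker(Δ_X̲ ↠ Δ_X̲^{ab} ⊗ ℤ/l)` — "`G_k` acts trivially on
  the cusp inertia groups modulo `l`", i.e. `μ_l ⊆ k`: print's "[in light of the assumption (∗)!] the natural
  [outer] action of `G_k` on `Δ_ε⁺ × Gal(X̲/C̲)` is trivial" (p. 38 l. 22–24; (∗) gives it via the Weil
  pairing — the typed field `star` only controls `Δ_X/Ker(Δ_X ↠ Δ_X^{ab} ⊗ ℤ/l)` and does not imply (L4));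
* (L3) `hL3 : ∀ c ∈ Δ_C̲ ∖ Δ_X̲, ∀ v ∈ Δ_X̲, c v c⁻¹ · v ∈ I_ε′ · I_ε″ · Ker(Δ_X̲ ↠ Δ_ε)` — "one verifies
  immediately that `ι` acts on `Δ_E ⊗ (ℤ/lℤ)` via multiplication by `−1`" (p. 38 l. 1), `Δ_E ⊗ ℤ/l` being the
  cokernel of `I_ε′ × I_ε″ → Δ_ε` (p. 37 l. 34–36);
* `hι : ∃ c ∈ Δ_C̲, c ∉ Δ_X̲` — `Gal(X̲/C̲) ≅ ℤ/2ℤ` is generated by a GEOMETRIC element (holds at any initial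
  Θ-data: abc-iut-L5-t2's `ThetaGeometry.not_PiCbar_le_PiX` + `aug_PiXbar`).

WHAT IS PROVED (for the frozen `D : PuncturedEllipticData` with cusp action `C : D.CuspGalois`):
* law-free: `CuspGalois.normal_deltaXbar`, `CuspGalois.normal_modLKer` (`Δ_X̲`, `Ker(Δ_X̲ ↠ Δ_X̲^{ab} ⊗ ℤ/l)`
  are normal in `Π_C`); `CuspGalois.act_mem_awayCusps` (`Π_C̲` permutes
  the nonzero cusps `≠ ε′, ε″`); `CuspGalois.exists_conj_inertia_mem`; `exists_l_succ_eq_two_mul` (`l` odd);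
  lattice facts `commutator_mem_jKer` …;
* under (L4): `CuspGalois.conj_inertia_mem` (`g I_x g⁻¹ ⊆ Ker · I_{g·x}`), hence print's "`ι` induces an
  isomorphism `I_ε′ ≅ I_ε″`" in the form `conj_inertia_ε1_mem` / `conj_inertia_ε2_mem` /
  `inertia_ε2_le_inertia_ε1_sup_jKer` / `inertia_ε1_le_inertia_ε2_sup_jKer`, and
  **`CuspGalois.jKer_normal_of_inertiaCentral` = the typed clause `ArrowCoveringClaims.jKer_normal`** (print:
  "the quotient `Δ_X̲ ↠ Δ_ε ↠ Δ_ε⁺` determines quotients `Π_X̲ ↠ J_X`, `Π_C̲ ↠ J_C`", p. 38 l. 9–13);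
* under (L3): `mem_inertia_sup_jKer_of_iotaNeg` — `v ≡ [v^{(l+1)/2}, ι̲]` modulo `I_ε′ · I_ε″ · Ker(Δ_X̲ ↠ Δ_ε)`
  ("since `l` is odd", p. 38 l. 1–2: `2` is invertible on the `(−1)`-eigenspace);
* under (L3)+(L4)+hι: **`CuspGalois.inertia_ε1_sup_of_laws`, `CuspGalois.inertia_ε2_sup_of_laws` = the typed
  clauses `ArrowCoveringClaims.inertia_ε1_sup`, `….inertia_ε2_sup`** ("the natural composite maps
  `I_ε′ ↪ Δ_ε ↠ Δ_ε⁺`, `I_ε″ ↪ Δ_ε ↠ Δ_ε⁺` determine isomorphisms" — surjectivity half, p. 38 l. 5–7).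

HONEST FRAMING: nothing here asserts abc proved or refuted or takes a side on [IUTchIII] Cor. 3.12; a clause
derived under a named law is an implication, not a discharge of the law; no printed statement is
strengthened; typed ≠ inhabited ≠ discharged.
-/

namespace Literature.IUT.HodgeTheaters

namespace PuncturedEllipticData

open scoped Pointwise
open Topology Literature.AnabelianGeometry.AbsoluteAnabelian

universe u

variable {D : PuncturedEllipticData.{u}}

namespace CuspGalois

variable (C : D.CuspGalois)

/-! ### Normality of `Δ_X̲` and of `Ker(Δ_X̲ ↠ Δ_X̲^{ab} ⊗ ℤ/l)` in `Π_C` -/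

include C in
/-- `Δ_X̲ = Π_X̲ ∩ Δ_C` is normal in `Π_C` (`X̲ → C` Galois). ([IUTchI] §1 p.37) [claim: Mochizuki2012, status: disputed] -/
theorem normal_deltaXbar : D.DeltaXbar.Normal := by
  haveI := C.normal_PiXbar
  haveI : D.DeltaC.Normal := D.E.normal_geom
  change (D.PiXbar ⊓ D.DeltaC).Normal
  infer_instance

include C in
/-- `Ker(Δ_X̲ ↠ Δ_X̲^{ab} ⊗ ℤ/l)` (the closure of commutators and `l`-th powers of `Δ_X̲`) is normal in
`Π_C`. ([IUTchI] §1 p.37) [claim: Mochizuki2012, status: disputed] -/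
theorem normal_modLKer : D.modLKer.Normal := by
  haveI := C.normal_deltaXbar
  haveI h1 : (⁅D.DeltaXbar, D.DeltaXbar⁆).Normal := inferInstance
  haveI h2 : (Subgroup.closure ((fun y : D.PiC => y ^ D.l) '' (D.DeltaXbar : Set D.PiC))).Normal := by
    refine ⟨fun n hn g => ?_⟩
    have hmap : (Subgroup.closure ((fun y : D.PiC => y ^ D.l) '' (D.DeltaXbar : Set D.PiC))).map
        (MulAut.conj g).toMonoidHom ≤
        Subgroup.closure ((fun y : D.PiC => y ^ D.l) '' (D.DeltaXbar : Set D.PiC)) := by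
      rw [MonoidHom.map_closure]
      refine Subgroup.closure_mono ?_
      rintro _ ⟨_, ⟨y, hy, rfl⟩, rfl⟩
      refine ⟨g * y * g⁻¹, (C.normal_deltaXbar).conj_mem y hy g, ?_⟩
      simp only [MulEquiv.coe_toMonoidHom, MulAut.conj_apply, conj_pow]
    exact hmap ⟨n, hn, rfl⟩
  change (⁅D.DeltaXbar, D.DeltaXbar⁆ ⊔
    Subgroup.closure ((fun y : D.PiC => y ^ D.l) '' (D.DeltaXbar : Set D.PiC))).topologicalClosure.Normal
  exact Subgroup.is_normal_topologicalClosure _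

/-! ### How `Π_C̲` permutes the cusps `ε⁰, ε′, ε″` -/

/-- `Π_C̲` permutes the set of NONZERO cusps of `X̲` different from `ε′, ε″` (it fixes `ε⁰` and preserves
`{ε′, ε″}`). ([IUTchI] §1 p.37) [claim: Mochizuki2012, status: disputed] -/
theorem act_mem_awayCusps {g : D.PiC} (hg : g ∈ D.PiCbar) {x : D.Cusp}
    (hx : D.IsNonzeroCusp x ∧ x ≠ D.ε1 ∧ x ≠ D.ε2) :
    D.IsNonzeroCusp (C.act g x) ∧ C.act g x ≠ D.ε1 ∧ C.act g x ≠ D.ε2 := by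
  obtain ⟨h0, h1, h2⟩ := hx
  by_cases hgX : g ∈ D.PiX
  · have htriv : C.act g x = x := C.act_apply_eq_self_of_mem_PiXbar ⟨hgX, hg⟩ x
    rw [htriv]
    exact ⟨h0, h1, h2⟩
  · refine ⟨fun h => h0 ?_, fun h => h2 ?_, fun h => h1 ?_⟩
    · exact (C.act g).injective (h.trans (C.act_ε0 g hg).symm)
    · exact (C.act g).injective (h.trans (C.act_ε2 hg hgX).symm)
    · exact (C.act g).injective (h.trans (C.act_ε1 g hg hgX).symm)

/-! ### Conjugating cusp inertia -/

/-- For `g ∈ Π_C` and `z ∈ I_x` there is `t ∈ Π_X̲` with `(t g) z (t g)⁻¹ ∈ I_{g·x}` (from `act_decomp`).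
([IUTchI] §1 p.37) [claim: Mochizuki2012, status: disputed] -/
theorem exists_conj_inertia_mem (g : D.PiC) (x : D.Cusp) {z : D.PiC} (hz : z ∈ D.inertia x) :
    ∃ t ∈ D.PiXbar, (t * g) * z * (t * g)⁻¹ ∈ D.inertia (C.act g x) := by
  obtain ⟨t, ht, h⟩ := C.act_decomp g x
  refine ⟨t, ht, ?_, ?_⟩
  · have hmem : MulAut.conj (t * g) • z ∈ MulAut.conj (t * g) • D.decomp x :=
      Subgroup.smul_mem_pointwise_smul _ _ _ hz.1
    rw [h, MulAut.smul_def, MulAut.conj_apply] at hmem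
    exact hmem
  · exact D.E.normal_geom.conj_mem z hz.2 (t * g)

/-- **Under (I3)**, conjugation by `g ∈ Π_C` carries `I_x` into `Ker(Δ_X̲ ↠ Δ_X̲^{ab} ⊗ ℤ/l) · I_{g·x}`:
`g z g⁻¹ = (t⁻¹ w t w⁻¹) · w` with `w ∈ I_{g·x}`, `t ∈ Π_X̲`. ([IUTchI] §1 p.38) [claim: Mochizuki2012, status: disputed] -/
theorem conj_inertia_mem
    (hI3 : ∀ (x : D.Cusp), ∀ g ∈ D.PiXbar, ∀ z ∈ D.inertia x, g * z * g⁻¹ * z⁻¹ ∈ D.modLKer)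
    (g : D.PiC) (x : D.Cusp) {z : D.PiC} (hz : z ∈ D.inertia x) :
    g * z * g⁻¹ ∈ D.modLKer ⊔ D.inertia (C.act g x) := by
  obtain ⟨t, ht, hw⟩ := C.exists_conj_inertia_mem g x hz
  set w := (t * g) * z * (t * g)⁻¹ with hw_def
  have key : g * z * g⁻¹ = (t⁻¹ * w * t⁻¹⁻¹ * w⁻¹) * w := by
    rw [hw_def]; group
  rw [key]
  exact Subgroup.mul_mem _ (Subgroup.mem_sup_left (hI3 _ t⁻¹ (D.PiXbar.inv_mem ht) w hw))
    (Subgroup.mem_sup_right hw)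

/-! ### The clause `jKer ⊴ Π_C̲` -/

include C in
/-- **[IUTchI] §1 p. 38, `jKer ⊴ Π_C̲` DERIVED under (I3)**: for `g ∈ Π_C̲` and `n ∈ jKer`, `g n g⁻¹ ∈ jKer`.
([IUTchI] §1 p.38) [claim: Mochizuki2012, status: disputed] -/
theorem conj_mem_jKer_of_inertiaCentral
    (hI3 : ∀ (x : D.Cusp), ∀ g ∈ D.PiXbar, ∀ z ∈ D.inertia x, g * z * g⁻¹ * z⁻¹ ∈ D.modLKer)
    {g n : D.PiC} (hg : g ∈ D.PiCbar) (hn : n ∈ D.jKer) : g * n * g⁻¹ ∈ D.jKer := by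
  haveI := C.normal_deltaXbar
  haveI := C.normal_modLKer
  -- it suffices to bound the image of each of the three generating pieces of `jKer`
  suffices hle : D.jKer ≤ D.jKer.comap (MulAut.conj g).toMonoidHom by
    have := hle hn
    simpa only [Subgroup.mem_comap, MulEquiv.coe_toMonoidHom, MulAut.conj_apply] using this
  have hmodL : D.modLKer ≤ D.jKer := le_sup_left.trans le_sup_left
  refine sup_le (sup_le ?_ ?_) ?_
  · -- `Ker(Δ_X̲ ↠ Δ_X̲^{ab} ⊗ ℤ/l)` is normal in `Π_C`
    intro m hm
    simp only [Subgroup.mem_comap, MulEquiv.coe_toMonoidHom, MulAut.conj_apply]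
    exact hmodL ((C.normal_modLKer).conj_mem m hm g)
  · -- inertia of the nonzero cusps `≠ ε′, ε″`: permuted by `Π_C̲` up to `Ker(…)` under (I3)
    refine iSup_le fun x => ?_
    intro z hz
    simp only [Subgroup.mem_comap, MulEquiv.coe_toMonoidHom, MulAut.conj_apply]
    have h := C.conj_inertia_mem hI3 g x.1 hz
    have hx' := C.act_mem_awayCusps hg x.2
    refine (sup_le hmodL ?_) h
    have : D.inertia (C.act g x.1) ≤ ⨆ (y : {y : D.Cusp // D.IsNonzeroCusp y ∧ y ≠ D.ε1 ∧ y ≠ D.ε2}),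
        D.inertia y.1 := le_iSup (fun y : {y : D.Cusp // D.IsNonzeroCusp y ∧ y ≠ D.ε1 ∧ y ≠ D.ε2} =>
          D.inertia y.1) ⟨C.act g x.1, hx'⟩
    exact this.trans (le_sup_right.trans le_sup_left)
  · -- the commutators `x c x⁻¹ c⁻¹`, `x ∈ Δ_X̲`, `c ∈ Δ_C̲ ∖ Δ_X̲`: a `Π_C̲`-stable set of generators
    rw [Subgroup.closure_le]
    rintro _ ⟨x, hx, c, hc, hcX, rfl⟩
    simp only [SetLike.mem_coe, Subgroup.mem_comap, MulEquiv.coe_toMonoidHom, MulAut.conj_apply]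
    refine Subgroup.mem_sup_right (Subgroup.subset_closure ⟨g * x * g⁻¹, (C.normal_deltaXbar).conj_mem x hx g,
      g * c * g⁻¹, ?_, ?_, by group⟩)
    · exact ⟨D.PiCbar.mul_mem (D.PiCbar.mul_mem hg hc.1) (D.PiCbar.inv_mem hg),
        D.E.normal_geom.conj_mem c hc.2 g⟩
    · intro h
      apply hcX
      have := (C.normal_deltaXbar).conj_mem _ h g⁻¹
      have e : g⁻¹ * (g * c * g⁻¹) * g⁻¹⁻¹ = c := by group
      rwa [e] at this

include C in
/-- **[IUTchI] §1 p. 38 — the typed clause `ArrowCoveringClaims.jKer_normal` DERIVED under (I3).**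
([IUTchI] §1 p.38) [claim: Mochizuki2012, status: disputed] -/
theorem jKer_normal_of_inertiaCentral
    (hI3 : ∀ (x : D.Cusp), ∀ g ∈ D.PiXbar, ∀ z ∈ D.inertia x, g * z * g⁻¹ * z⁻¹ ∈ D.modLKer) :
    (D.jKer.subgroupOf D.PiCbar).Normal :=
  (Subgroup.normal_subgroupOf_iff
      (D.jKer_le_deltaXbar.trans (D.deltaXbar_le_deltaCbar.trans D.deltaCbar_le_piCbar))).mpr
    fun _ _ hn hk => C.conj_mem_jKer_of_inertiaCentral hI3 hk hn


/-! ### `ι̲ : I_ε′ ⥲ I_ε″` modulo `Ker(Δ_X̲ ↠ Δ_X̲^{ab} ⊗ ℤ/l)` — DERIVED (print p. 37 l. 39: "`ι` induces an isomorphism `I_ε′ ≅ I_ε″`") -/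

include C in
/-- Under (I3): `ι̲ I_ε′ ι̲⁻¹ ⊆ Ker · I_ε″` for any `ι̲ ∈ Π_C̲ ∖ Π_X`. ([IUTchI] §1 p.37) [claim: Mochizuki2012, status: disputed] -/
theorem conj_inertia_ε1_mem
    (hI3 : ∀ (x : D.Cusp), ∀ g ∈ D.PiXbar, ∀ z ∈ D.inertia x, g * z * g⁻¹ * z⁻¹ ∈ D.modLKer)
    {c : D.PiC} (hc : c ∈ D.PiCbar) (hcX : c ∉ D.PiX) {z : D.PiC} (hz : z ∈ D.inertia D.ε1) :
    c * z * c⁻¹ ∈ D.modLKer ⊔ D.inertia D.ε2 := by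
  have h := C.conj_inertia_mem hI3 c D.ε1 hz
  rwa [C.act_ε1 c hc hcX] at h

include C in
/-- Under (I3): `ι̲ I_ε″ ι̲⁻¹ ⊆ Ker · I_ε′` for any `ι̲ ∈ Π_C̲ ∖ Π_X`. ([IUTchI] §1 p.37) [claim: Mochizuki2012, status: disputed] -/
theorem conj_inertia_ε2_mem
    (hI3 : ∀ (x : D.Cusp), ∀ g ∈ D.PiXbar, ∀ z ∈ D.inertia x, g * z * g⁻¹ * z⁻¹ ∈ D.modLKer)
    {c : D.PiC} (hc : c ∈ D.PiCbar) (hcX : c ∉ D.PiX) {z : D.PiC} (hz : z ∈ D.inertia D.ε2) :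
    c * z * c⁻¹ ∈ D.modLKer ⊔ D.inertia D.ε1 := by
  have h := C.conj_inertia_mem hI3 c D.ε2 hz
  rwa [C.act_ε2 hc hcX] at h

end CuspGalois

/-! ### Small facts about the `§1` lattice of subgroups (law-free) -/

/-- `Ker(Δ_X̲ ↠ Δ_X̲^{ab} ⊗ ℤ/l) ⊆ Ker(Δ_X̲ ↠ Δ_ε)`. ([IUTchI] §1 p.37) [claim: Mochizuki2012, status: disputed] -/
theorem modLKer_le_deltaEpsKer : D.modLKer ≤ D.deltaEpsKer := le_sup_left

/-- `Ker(Δ_X̲ ↠ Δ_ε) ⊆ jKer`. ([IUTchI] §1 p.38) [claim: Mochizuki2012, status: disputed] -/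
theorem deltaEpsKer_le_jKer : D.deltaEpsKer ≤ D.jKer := le_sup_left

/-- `x^l ∈ Ker(Δ_X̲ ↠ Δ_X̲^{ab} ⊗ ℤ/l)` for `x ∈ Δ_X̲`. ([IUTchI] §1 p.37) [claim: Mochizuki2012, status: disputed] -/
theorem pow_l_mem_modLKer {x : D.PiC} (hx : x ∈ D.DeltaXbar) : x ^ D.l ∈ D.modLKer :=
  Subgroup.le_topologicalClosure _ (Subgroup.mem_sup_right (Subgroup.subset_closure ⟨x, hx, rfl⟩))

/-- `[x, y] ∈ Ker(Δ_X̲ ↠ Δ_X̲^{ab} ⊗ ℤ/l)` for `x, y ∈ Δ_X̲`. ([IUTchI] §1 p.37) [claim: Mochizuki2012, status: disputed] -/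
theorem commutator_mem_modLKer {x y : D.PiC} (hx : x ∈ D.DeltaXbar) (hy : y ∈ D.DeltaXbar) :
    x * y * x⁻¹ * y⁻¹ ∈ D.modLKer := by
  have h := Subgroup.commutator_mem_commutator hx hy
  rw [commutatorElement_def] at h
  exact Subgroup.le_topologicalClosure _ (Subgroup.mem_sup_left h)

/-- The commutator generator of `jKer`: `x c x⁻¹ c⁻¹ ∈ jKer` for `x ∈ Δ_X̲`, `c ∈ Δ_C̲ ∖ Δ_X̲`.
([IUTchI] §1 p.38) [claim: Mochizuki2012, status: disputed] -/
theorem commutator_mem_jKer {x c : D.PiC} (hx : x ∈ D.DeltaXbar) (hc : c ∈ D.DeltaCbar)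
    (hcX : c ∉ D.DeltaXbar) : x * c * x⁻¹ * c⁻¹ ∈ D.jKer :=
  Subgroup.mem_sup_right (Subgroup.subset_closure ⟨x, hx, c, hc, hcX, rfl⟩)

/-- An element of `Δ_C̲ ∖ Δ_X̲` lies in `Π_C̲ ∖ Π_X`. ([IUTchI] §1 p.37) [claim: Mochizuki2012, status: disputed] -/
theorem not_mem_piX_of_mem_deltaCbar {c : D.PiC} (hc : c ∈ D.DeltaCbar) (hcX : c ∉ D.DeltaXbar) :
    c ∉ D.PiX := fun h => hcX ⟨⟨h, hc.1⟩, hc.2⟩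

/-- `l` is odd (`l` is prime to `6`): `l + 1 = 2k`. ([IUTchI] §1 p.37) [claim: Mochizuki2012, status: disputed] -/
theorem exists_l_succ_eq_two_mul : ∃ k : ℕ, D.l + 1 = 2 * k := by
  have h2 : Nat.Coprime 2 D.l := (Nat.Coprime.coprime_dvd_left (by norm_num : 2 ∣ 6) D.coprime_six.symm)
  obtain ⟨m, hm⟩ := Nat.coprime_two_left.mp h2
  exact ⟨m + 1, by omega⟩

/-! ### `I_ε′ ↠ Δ_ε⁺` and `I_ε″ ↠ Δ_ε⁺` — DERIVED from (L3) «ι acts on Δ_E ⊗ ℤ/l via −1» and (I3) -/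

namespace CuspGalois

variable (C : D.CuspGalois)

include C in
/-- Under (I3): `I_ε″ ⊆ I_ε′ · jKer` (`y = [y, ι̲] · ι̲ y ι̲⁻¹` with `ι̲ y ι̲⁻¹ ∈ Ker · I_ε′`).
([IUTchI] §1 p.38) [claim: Mochizuki2012, status: disputed] -/
theorem inertia_ε2_le_inertia_ε1_sup_jKer
    (hI3 : ∀ (x : D.Cusp), ∀ g ∈ D.PiXbar, ∀ z ∈ D.inertia x, g * z * g⁻¹ * z⁻¹ ∈ D.modLKer)
    {c : D.PiC} (hc : c ∈ D.DeltaCbar) (hcX : c ∉ D.DeltaXbar) :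
    D.inertia D.ε2 ≤ D.inertia D.ε1 ⊔ D.jKer := by
  intro y hy
  have h1 := C.conj_inertia_ε2_mem hI3 hc.1 (D.not_mem_piX_of_mem_deltaCbar hc hcX) hy
  have hj := D.commutator_mem_jKer (D.inertia_le_deltaXbar _ hy) hc hcX
  have e : y = (y * c * y⁻¹ * c⁻¹) * (c * y * c⁻¹) := by group
  rw [e]
  exact Subgroup.mul_mem _ (Subgroup.mem_sup_right hj)
    ((sup_le (D.modLKer_le_jKer.trans le_sup_right) le_sup_left) h1)

include C in
/-- Under (I3): `I_ε′ ⊆ I_ε″ · jKer`. ([IUTchI] §1 p.38) [claim: Mochizuki2012, status: disputed] -/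
theorem inertia_ε1_le_inertia_ε2_sup_jKer
    (hI3 : ∀ (x : D.Cusp), ∀ g ∈ D.PiXbar, ∀ z ∈ D.inertia x, g * z * g⁻¹ * z⁻¹ ∈ D.modLKer)
    {c : D.PiC} (hc : c ∈ D.DeltaCbar) (hcX : c ∉ D.DeltaXbar) :
    D.inertia D.ε1 ≤ D.inertia D.ε2 ⊔ D.jKer := by
  intro y hy
  have h1 := C.conj_inertia_ε1_mem hI3 hc.1 (D.not_mem_piX_of_mem_deltaCbar hc hcX) hy
  have hj := D.commutator_mem_jKer (D.inertia_le_deltaXbar _ hy) hc hcX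
  have e : y = (y * c * y⁻¹ * c⁻¹) * (c * y * c⁻¹) := by group
  rw [e]
  exact Subgroup.mul_mem _ (Subgroup.mem_sup_right hj)
    ((sup_le (D.modLKer_le_jKer.trans le_sup_right) le_sup_left) h1)

end CuspGalois

/-- **Under (L3)**: every `v ∈ Δ_X̲` lies in `(I_ε′ · I_ε″ · Ker(Δ_X̲ ↠ Δ_ε)) · jKer` — print's "`ι` acts on
`Δ_E ⊗ (ℤ/lℤ)` via multiplication by `−1`. In particular, since `l` is odd …": with `b := v^{(l+1)/2}`,
`v ≡ [b, ι̲]` modulo `I_ε′ · I_ε″ · Ker(Δ_X̲ ↠ Δ_ε)`. ([IUTchI] §1 p.38) [claim: Mochizuki2012, status: disputed] -/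
theorem mem_inertia_sup_jKer_of_iotaNeg
    (hL3 : ∀ c ∈ D.DeltaCbar, c ∉ D.DeltaXbar → ∀ v ∈ D.DeltaXbar,
      c * v * c⁻¹ * v ∈ D.inertia D.ε1 ⊔ D.inertia D.ε2 ⊔ D.deltaEpsKer)
    {c : D.PiC} (hc : c ∈ D.DeltaCbar) (hcX : c ∉ D.DeltaXbar) {v : D.PiC} (hv : v ∈ D.DeltaXbar) :
    v ∈ D.inertia D.ε1 ⊔ D.inertia D.ε2 ⊔ D.jKer := by
  obtain ⟨k, hk⟩ := D.exists_l_succ_eq_two_mul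
  -- `M := I_ε′ ⊔ I_ε″ ⊔ Ker(Δ_X̲ ↠ Δ_ε) ⊆ Δ_X̲`, containing the commutators and `l`-th powers of `Δ_X̲`
  have hMle : D.inertia D.ε1 ⊔ D.inertia D.ε2 ⊔ D.deltaEpsKer ≤ D.DeltaXbar :=
    sup_le (sup_le (D.inertia_le_deltaXbar _) (D.inertia_le_deltaXbar _)) D.deltaEpsKer_le_deltaXbar
  have hmodL : D.modLKer ≤ D.inertia D.ε1 ⊔ D.inertia D.ε2 ⊔ D.deltaEpsKer :=
    D.modLKer_le_deltaEpsKer.trans le_sup_right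
  have hMJ : D.inertia D.ε1 ⊔ D.inertia D.ε2 ⊔ D.deltaEpsKer ≤ D.inertia D.ε1 ⊔ D.inertia D.ε2 ⊔ D.jKer :=
    sup_le_sup_left D.deltaEpsKer_le_jKer _
  set b : D.PiC := v ^ k with hb_def
  have hb : b ∈ D.DeltaXbar := Subgroup.pow_mem _ hv _
  have hj : b * c * b⁻¹ * c⁻¹ ∈ D.jKer := D.commutator_mem_jKer hb hc hcX
  have hm : c * b * c⁻¹ * b ∈ D.inertia D.ε1 ⊔ D.inertia D.ε2 ⊔ D.deltaEpsKer := hL3 c hc hcX b hb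
  -- `v · [b, ι̲]⁻¹ = (v m v⁻¹) · (v · (b b)⁻¹)` with `m := ι̲ b ι̲⁻¹ b`
  have key : v * (b * c * b⁻¹ * c⁻¹)⁻¹ = (v * (c * b * c⁻¹ * b) * v⁻¹) * (v * (b * b)⁻¹) := by group
  have hbb : v * (b * b)⁻¹ = (v ^ D.l)⁻¹ := by
    rw [hb_def, ← pow_add, show k + k = D.l + 1 by omega, pow_succ, mul_inv_rev, mul_inv_cancel_left]
  have h1 : v * (c * b * c⁻¹ * b) * v⁻¹ ∈ D.inertia D.ε1 ⊔ D.inertia D.ε2 ⊔ D.deltaEpsKer := by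
    have e : v * (c * b * c⁻¹ * b) * v⁻¹ =
        (v * (c * b * c⁻¹ * b) * v⁻¹ * (c * b * c⁻¹ * b)⁻¹) * (c * b * c⁻¹ * b) := by group
    rw [e]
    exact Subgroup.mul_mem _ (hmodL (D.commutator_mem_modLKer hv (hMle hm))) hm
  have h2 : v * (b * b)⁻¹ ∈ D.inertia D.ε1 ⊔ D.inertia D.ε2 ⊔ D.deltaEpsKer := by
    rw [hbb]
    exact Subgroup.inv_mem _ (hmodL (D.pow_l_mem_modLKer hv))
  have h3 : v * (b * c * b⁻¹ * c⁻¹)⁻¹ ∈ D.inertia D.ε1 ⊔ D.inertia D.ε2 ⊔ D.deltaEpsKer := by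
    rw [key]; exact Subgroup.mul_mem _ h1 h2
  have e : v = (v * (b * c * b⁻¹ * c⁻¹)⁻¹) * (b * c * b⁻¹ * c⁻¹) := by group
  rw [e]
  exact Subgroup.mul_mem _ (hMJ h3) (Subgroup.mem_sup_right hj)

namespace CuspGalois

variable (C : D.CuspGalois)

include C in
/-- **[IUTchI] §1 p. 38 — the typed clause `ArrowCoveringClaims.inertia_ε1_sup` (`I_ε′ ⥲ Δ_ε⁺`, i.e.
`I_ε′ · jKer = Δ_X̲`) DERIVED** from (L3) «ι acts on Δ_E ⊗ ℤ/l via −1», (I3) «μ_l ⊆ k», the cusp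
action, and the existence of `ι̲ ∈ Δ_C̲ ∖ Δ_X̲`. ([IUTchI] §1 p.38) [claim: Mochizuki2012, status: disputed] -/
theorem inertia_ε1_sup_of_laws
    (hI3 : ∀ (x : D.Cusp), ∀ g ∈ D.PiXbar, ∀ z ∈ D.inertia x, g * z * g⁻¹ * z⁻¹ ∈ D.modLKer)
    (hL3 : ∀ c ∈ D.DeltaCbar, c ∉ D.DeltaXbar → ∀ v ∈ D.DeltaXbar,
      c * v * c⁻¹ * v ∈ D.inertia D.ε1 ⊔ D.inertia D.ε2 ⊔ D.deltaEpsKer)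
    (hι : ∃ c ∈ D.DeltaCbar, c ∉ D.DeltaXbar) :
    D.inertia D.ε1 ⊔ D.jKer = D.DeltaXbar := by
  refine le_antisymm (sup_le (D.inertia_le_deltaXbar _) D.jKer_le_deltaXbar) fun v hv => ?_
  obtain ⟨c, hc, hcX⟩ := hι
  have h := D.mem_inertia_sup_jKer_of_iotaNeg hL3 hc hcX hv
  exact (sup_le (sup_le le_sup_left ((C.inertia_ε2_le_inertia_ε1_sup_jKer hI3 hc hcX)))
    le_sup_right) h

include C in
/-- **[IUTchI] §1 p. 38 — the typed clause `ArrowCoveringClaims.inertia_ε2_sup` (`I_ε″ ⥲ Δ_ε⁺`)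
DERIVED** likewise. ([IUTchI] §1 p.38) [claim: Mochizuki2012, status: disputed] -/
theorem inertia_ε2_sup_of_laws
    (hI3 : ∀ (x : D.Cusp), ∀ g ∈ D.PiXbar, ∀ z ∈ D.inertia x, g * z * g⁻¹ * z⁻¹ ∈ D.modLKer)
    (hL3 : ∀ c ∈ D.DeltaCbar, c ∉ D.DeltaXbar → ∀ v ∈ D.DeltaXbar,
      c * v * c⁻¹ * v ∈ D.inertia D.ε1 ⊔ D.inertia D.ε2 ⊔ D.deltaEpsKer)
    (hι : ∃ c ∈ D.DeltaCbar, c ∉ D.DeltaXbar) :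
    D.inertia D.ε2 ⊔ D.jKer = D.DeltaXbar := by
  refine le_antisymm (sup_le (D.inertia_le_deltaXbar _) D.jKer_le_deltaXbar) fun v hv => ?_
  obtain ⟨c, hc, hcX⟩ := hι
  have h := D.mem_inertia_sup_jKer_of_iotaNeg hL3 hc hcX hv
  exact (sup_le (sup_le ((C.inertia_ε1_le_inertia_ε2_sup_jKer hI3 hc hcX)) le_sup_left)
    le_sup_right) h

end CuspGalois

end PuncturedEllipticData

end Literature.IUT.HodgeTheaters
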